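import Mathlib
import Summits.ResolutionOfSingularities.ResolutionOfSingularities.Theorems.RisoStrataRisoCentresResolvePlumbing
import Summits.ResolutionOfSingularities.ResolutionOfSingularities.Theorems.RisoStrataRtdLocalArcEquiv

/-!
# Route RisoStrata — crux `RisoCentresResolve` (stmt-ResolutionOfSingularities-18546),
# line `Sketch`: stub `stub_rcrPathIndep` (path independence of the tower for a Zariski-local
# cut predicate)

Two finitely generated `k`-subalgebras `B, B' ⊆ O` of `K` with the same local ring
`L = risoLoc O B = risoLoc O B'` at the centre of the valuation ring `O` and a common basic-open
refinement (`B' ⊆ B[s⁻¹]`, `B ⊆ B'[s'⁻¹]`, `s, s'` units of `O`) have admissible blow-up charts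
`B[Cen/x]`, `B'[Cen'/x']` with the same local ring at the centre of `O`, provided the cut
predicate `P` is Zariski-local (`RisoLocal P`).

Proof sketch.
* `pathIndep_cen_of_isLocalization` / `pathIndep_cen_local` (the heart, pure algebra): along
  `B ⊆ B[s⁻¹]` (the localisation away from `s`, `arcEquiv_isLocalization`) the centre ideal
  extends: `Cen(B) ⊆ Cen(B[s⁻¹])` and `Cen(B[s⁻¹]) ⊆ {c / s ^ e | c ∈ Cen(B)}`. Maximal ideals of
  `B[s⁻¹]` are the extensions of the maximal ideals of the Jacobson ring `B` avoiding `s`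
  (`IsLocalization.isMaximal_iff_isMaximal_disjoint`, `isMaximal_of_isMaximal_disjoint`), with
  isomorphic local rings (`pathIndep_isRegularLocalRing_iff`, localisation of a localisation), and
  `P` matches by `RisoLocal`.
* `pathIndep_star`: applying this along `B ⊆ B[s⁻¹] ⊆ B[s⁻¹][s'⁻¹] = B'[s'⁻¹][s⁻¹] ⊇ B'[s'⁻¹] ⊇ B'`
  shows every `c' ∈ Cen(B')` is `c / (s ^ e s' ^ e')` with `c ∈ Cen(B)`, and symmetrically.
* `pathIndep_le`: hence `x'/x` lies in `L₁ = risoLoc O (B[Cen/x])` and is a unit of `O`, so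
  `B'[Cen'/x'] ⊆ L₁`; idempotence and monotonicity of `risoLoc` (plumbing) and symmetry conclude.

No definitions, no named facts.
-/

noncomputable section

set_option linter.dupNamespace false -- mandated namespace of this single-conjunct summit

namespace Summit.ResolutionOfSingularities.ResolutionOfSingularities.Theorems

/-- Membership in the centre ideal `risoCen P B d`: lying in every singular maximal ideal cut by
`P` at level `d`. [folklore] -/
theorem pathIndep_mem_risoCen_iff {k K : Type} [Field k] [Field K] [Algebra k K]
    (P : ∀ B : Subalgebra k K, Ideal ↥B → ℕ → Prop) (B : Subalgebra k K) (d : ℕ) (x : ↥B) :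
    x ∈ risoCen P B d ↔ ∀ (m : Ideal ↥B) (hm : m.IsMaximal),
      ¬ IsRegularLocalRing (Localization (@Ideal.primeCompl ↥B _ m hm.isPrime)) → P B m d →
        x ∈ m := by
  unfold risoCen
  simp only [Submodule.mem_iInf, Set.mem_setOf_eq]
  constructor
  · intro h m hm hreg hP
    exact h m ⟨hm, hreg, hP⟩
  · rintro h m ⟨hm, hreg, hP⟩
    exact h m hm hreg hP

/-- **Regularity at a maximal ideal is unchanged under localisation**: if `S` is a localisation
of `R` and `q = p ∩ R` for a maximal ideal `p` of `S`, then `R_q ≅ S_p`, so one is a regular local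
ring iff the other is. [folklore] -/
theorem pathIndep_isRegularLocalRing_iff {R S : Type*} [CommRing R] [CommRing S] [Algebra R S]
    (M : Submonoid R) [IsLocalization M S] (p : Ideal S) (hp : p.IsMaximal) (q : Ideal R)
    (hq : q.IsMaximal) (hpq : q = p.comap (algebraMap R S)) :
    IsRegularLocalRing (Localization (@Ideal.primeCompl R _ q hq.isPrime)) ↔
      IsRegularLocalRing (Localization (@Ideal.primeCompl S _ p hp.isPrime)) := by
  subst hpq
  haveI : p.IsPrime := hp.isPrime
  haveI : IsLocalization.AtPrime (Localization.AtPrime p) (p.comap (algebraMap R S)) :=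
    IsLocalization.isLocalization_isLocalization_atPrime_isLocalization M
      (Localization.AtPrime p) p
  let e : Localization.AtPrime (p.comap (algebraMap R S)) ≃+* Localization.AtPrime p :=
    (IsLocalization.algEquiv (p.comap (algebraMap R S)).primeCompl
      (Localization.AtPrime (p.comap (algebraMap R S))) (Localization.AtPrime p)).toRingEquiv
  exact ⟨fun _ => IsRegularLocalRing.of_ringEquiv e,
    fun _ => IsRegularLocalRing.of_ringEquiv e.symm⟩

/-- **Localisation lemma for the centre ideal** (abstract form). Let `B ≤ Bs ⊆ K` with `Bs`
the localisation of the finitely generated `k`-algebra `B` away from `s ∈ B`, every element of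
`Bs` a fraction `b / s ^ e`, and the cut `P` compatible with contraction of maximal ideals. Then
the centre ideal of `Bs` is the extension of the centre ideal of `B`: the image of `Cen(B)` lies in
`Cen(Bs)`, and every element of `Cen(Bs)` is `c / s ^ e` with `c ∈ Cen(B)`. (Maximal ideals of
`Bs` are the extensions of the maximal ideals of the Jacobson ring `B` avoiding `s`, with the same
local rings.) [folklore] -/
theorem pathIndep_cen_of_isLocalization {k K : Type} [Field k] [Field K] [Algebra k K]
    (P : ∀ B : Subalgebra k K, Ideal ↥B → ℕ → Prop) {B Bs : Subalgebra k K} (hle : B ≤ Bs)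
    (hB : B.FG) {s : K} (hs : s ∈ B) (hs0 : s ≠ 0)
    (hloc : letI := (Subalgebra.inclusion hle).toRingHom.toAlgebra
      IsLocalization.Away (⟨s, hs⟩ : ↥B) ↥Bs)
    (hfrac : ∀ z ∈ Bs, ∃ b ∈ B, ∃ e : ℕ, z = b * (s ^ e)⁻¹) {d : ℕ}
    (hPloc : ∀ m' : Ideal ↥Bs, m'.IsMaximal →
      (P Bs m' d ↔ P B (m'.comap (Subalgebra.inclusion hle)) d)) :
    (∀ c ∈ risoCen P B d, Subalgebra.inclusion hle c ∈ risoCen P Bs d) ∧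
    (∀ y ∈ risoCen P Bs d, ∃ c ∈ risoCen P B d, ∃ e : ℕ, (y : K) = c * (s ^ e)⁻¹) := by
  letI instAlg : Algebra ↥B ↥Bs := (Subalgebra.inclusion hle).toRingHom.toAlgebra
  haveI : IsLocalization.Away (⟨s, hs⟩ : ↥B) ↥Bs := hloc
  haveI : Algebra.FiniteType k ↥B := (Subalgebra.fg_iff_finiteType B).mp hB
  haveI : IsJacobsonRing ↥B := isJacobsonRing_of_finiteType (A := k) (B := ↥B)
  have halg : ∀ b : ↥B, algebraMap ↥B ↥Bs b = Subalgebra.inclusion hle b := fun _ => rfl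
  have hcomap : ∀ I : Ideal ↥Bs, I.comap (Subalgebra.inclusion hle) = I.under ↥B := fun _ => rfl
  refine ⟨fun c hc => ?_, fun y hy => ?_⟩
  · rw [pathIndep_mem_risoCen_iff] at hc ⊢
    intro m' hm' hreg hPm
    have hm : (m'.under ↥B).IsMaximal :=
      ((IsLocalization.isMaximal_iff_isMaximal_disjoint (↥Bs) (⟨s, hs⟩ : ↥B) m').mp hm').1
    have hreg' : ¬ IsRegularLocalRing
        (Localization (@Ideal.primeCompl ↥B _ (m'.under ↥B) hm.isPrime)) := by
      rwa [pathIndep_isRegularLocalRing_iff (Submonoid.powers (⟨s, hs⟩ : ↥B)) m' hm'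
        (m'.under ↥B) hm rfl]
    have hP' : P B (m'.under ↥B) d := by rw [← hcomap]; exact (hPloc m' hm').mp hPm
    exact hc _ hm hreg' hP'
  · obtain ⟨b, hb, e, hyb⟩ := hfrac y y.2
    have hbs : (⟨b * s, B.mul_mem hb hs⟩ : ↥B) = ⟨b, hb⟩ * ⟨s, hs⟩ := rfl
    refine ⟨⟨b * s, B.mul_mem hb hs⟩, ?_, e + 1, ?_⟩
    · rw [pathIndep_mem_risoCen_iff] at hy ⊢
      intro m hm hreg hPm
      by_cases hsm : (⟨s, hs⟩ : ↥B) ∈ m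
      · rw [hbs]; exact m.mul_mem_left _ hsm
      · haveI : m.IsPrime := hm.isPrime
        have hm' : (m.map (algebraMap ↥B ↥Bs)).IsMaximal :=
          IsLocalization.isMaximal_of_isMaximal_disjoint (⟨s, hs⟩ : ↥B) m hm hsm
        have hunder : (m.map (algebraMap ↥B ↥Bs)).under ↥B = m :=
          IsLocalization.under_map_of_isPrime_disjoint (Submonoid.powers (⟨s, hs⟩ : ↥B)) ↥Bs
            hm.isPrime ((Ideal.disjoint_powers_iff_notMem_of_isPrime (⟨s, hs⟩ : ↥B)).mpr hsm)
        have hreg' : ¬ IsRegularLocalRing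
            (Localization (@Ideal.primeCompl ↥Bs _ _ hm'.isPrime)) := by
          rwa [← pathIndep_isRegularLocalRing_iff (Submonoid.powers (⟨s, hs⟩ : ↥B)) _ hm' m hm
            hunder.symm]
        have hP' : P Bs (m.map (algebraMap ↥B ↥Bs)) d := by
          rw [hPloc _ hm', hcomap, hunder]; exact hPm
        have hym : y ∈ m.map (algebraMap ↥B ↥Bs) := hy _ hm' hreg' hP'
        have hbm : Subalgebra.inclusion hle ⟨b, hb⟩ ∈ m.map (algebraMap ↥B ↥Bs) := by
          have : Subalgebra.inclusion hle ⟨b, hb⟩ =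
              y * Subalgebra.inclusion hle (⟨s, hs⟩ ^ e) := by
            apply Subtype.ext
            simp only [map_pow, Subalgebra.coe_inclusion, Subalgebra.coe_mul, Subalgebra.coe_pow]
            rw [hyb, inv_mul_cancel_right₀ (pow_ne_zero e hs0)]
          rw [this]; exact Ideal.mul_mem_right _ _ hym
        have hbm' : (⟨b, hb⟩ : ↥B) ∈ m := by
          rw [← hunder, Ideal.under_def, Ideal.mem_comap, halg]; exact hbm
        rw [hbs]; exact m.mul_mem_right _ hbm'
    · change (y : K) = b * s * (s ^ (e + 1))⁻¹
      rw [hyb]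
      field_simp
      ring

/-- **Localisation lemma for the centre ideal along `B ⊆ B[s⁻¹]`** for a Zariski-local cut `P`:
`Cen(B) ⊆ Cen(B[s⁻¹])` and every element of `Cen(B[s⁻¹])` is `c / s ^ e` with `c ∈ Cen(B)`.
[folklore] -/
theorem pathIndep_cen_local {k K : Type} [Field k] [Field K] [Algebra k K]
    (P : ∀ B : Subalgebra k K, Ideal ↥B → ℕ → Prop) (hP : RisoLocal P) {B : Subalgebra k K}
    (hB : B.FG) {s : K} (hs : s ∈ B) (hs0 : s ≠ 0) (d : ℕ) :
    (∀ c ∈ risoCen P B d,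
      ∃ c₁ ∈ risoCen P (Algebra.adjoin k ((B : Set K) ∪ {s⁻¹})) d, (c₁ : K) = c) ∧
    (∀ y ∈ risoCen P (Algebra.adjoin k ((B : Set K) ∪ {s⁻¹})) d,
      ∃ c ∈ risoCen P B d, ∃ e : ℕ, (y : K) = c * (s ^ e)⁻¹) := by
  have hle : B ≤ Algebra.adjoin k ((B : Set K) ∪ {s⁻¹}) :=
    fun _ hb => Algebra.subset_adjoin (Set.mem_union_left _ hb)
  obtain ⟨h₁, h₂⟩ := pathIndep_cen_of_isLocalization P hle hB hs hs0
    (arcEquiv_isLocalization hs hs0 hle) (fun z hz => arcEquiv_exists_of_mem_adjoin hs hs0 hz)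
    (fun m' hm' => hP B s hs hs0 hB m' hm' d)
  exact ⟨fun c hc => ⟨_, h₁ c hc, rfl⟩, h₂⟩

/-- `B[x] = adjoin k (B ∪ {x})` is finitely generated when `B` is. [folklore] -/
theorem pathIndep_fg_adjoin {k K : Type} [Field k] [Field K] [Algebra k K] {B : Subalgebra k K}
    (hB : B.FG) (x : K) : (Algebra.adjoin k ((B : Set K) ∪ {x})).FG := by
  rw [Algebra.adjoin_union, Algebra.adjoin_eq]
  exact hB.sup ⟨{x}, by rw [Finset.coe_singleton]⟩

/-- Transport of centre elements along an equality of subalgebras. [folklore] -/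
theorem pathIndep_cen_congr {k K : Type} [Field k] [Field K] [Algebra k K]
    (P : ∀ B : Subalgebra k K, Ideal ↥B → ℕ → Prop) {C C' : Subalgebra k K} (h : C = C') (d : ℕ)
    (y : ↥C) (hy : y ∈ risoCen P C d) : ∃ y' ∈ risoCen P C' d, (y' : K) = y := by
  subst h
  exact ⟨y, hy, rfl⟩

/-- One inclusion of `B'[s'⁻¹][s⁻¹] = B[s⁻¹][s'⁻¹]` when `B' ⊆ B[s⁻¹]`. [folklore] -/
theorem pathIndep_adjoin_adjoin_le {k K : Type} [Field k] [Field K] [Algebra k K]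
    {B B' : Subalgebra k K} {s : K} (s' : K)
    (h₁ : (B' : Set K) ⊆ Algebra.adjoin k ((B : Set K) ∪ {s⁻¹})) :
    Algebra.adjoin k ((Algebra.adjoin k ((B' : Set K) ∪ {s'⁻¹}) : Set K) ∪ {s⁻¹}) ≤
      Algebra.adjoin k ((Algebra.adjoin k ((B : Set K) ∪ {s⁻¹}) : Set K) ∪ {s'⁻¹}) := by
  refine Algebra.adjoin_le ?_
  rintro y (hy | hy)
  · refine (Algebra.adjoin_le ?_ : Algebra.adjoin k ((B' : Set K) ∪ {s'⁻¹}) ≤ _) hy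
    rintro z (hz | hz)
    · exact Algebra.subset_adjoin (Set.mem_union_left _ (h₁ hz))
    · exact Algebra.subset_adjoin (Set.mem_union_right _ hz)
  · rw [Set.mem_singleton_iff] at hy
    subst hy
    exact Algebra.subset_adjoin (Set.mem_union_left _
      (Algebra.subset_adjoin (Set.mem_union_right _ rfl)))

/-- **Comparison of the centre ideals of two charts with a common basic-open refinement**
(`B' ⊆ B[s⁻¹]`, `B ⊆ B'[s'⁻¹]`, `P` Zariski-local): every element of `Cen(B')` is
`c / (s ^ e s' ^ e')` with `c ∈ Cen(B)`. [folklore] -/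
theorem pathIndep_star {k K : Type} [Field k] [Field K] [Algebra k K]
    (P : ∀ B : Subalgebra k K, Ideal ↥B → ℕ → Prop) (hP : RisoLocal P) {B B' : Subalgebra k K}
    (hB : B.FG) (hB' : B'.FG) {s s' : K} (hs : s ∈ B) (hs' : s' ∈ B') (hs0 : s ≠ 0)
    (hs'0 : s' ≠ 0) (h₁ : (B' : Set K) ⊆ Algebra.adjoin k ((B : Set K) ∪ {s⁻¹}))
    (h₂ : (B : Set K) ⊆ Algebra.adjoin k ((B' : Set K) ∪ {s'⁻¹})) (d : ℕ) :
    ∀ c' ∈ risoCen P B' d, ∃ c ∈ risoCen P B d, ∃ e e' : ℕ,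
      (c' : K) = c * (s ^ e)⁻¹ * (s' ^ e')⁻¹ := by
  intro c' hc'
  -- `B₁ := B[s⁻¹]`, `C := B₁[s'⁻¹]`, `B₁' := B'[s'⁻¹]`, `C' := B₁'[s⁻¹]`, and `C' = C`
  have hC : Algebra.adjoin k ((Algebra.adjoin k ((B' : Set K) ∪ {s'⁻¹}) : Set K) ∪ {s⁻¹}) =
      Algebra.adjoin k ((Algebra.adjoin k ((B : Set K) ∪ {s⁻¹}) : Set K) ∪ {s'⁻¹}) :=
    le_antisymm (pathIndep_adjoin_adjoin_le s' h₁) (pathIndep_adjoin_adjoin_le s h₂)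
  have hsB₁' : s ∈ Algebra.adjoin k ((B' : Set K) ∪ {s'⁻¹}) := h₂ hs
  have hs'B₁ : s' ∈ Algebra.adjoin k ((B : Set K) ∪ {s⁻¹}) := h₁ hs'
  -- push `c'` up to `C'`
  obtain ⟨c₁', hc₁', hc₁'eq⟩ := (pathIndep_cen_local P hP hB' hs' hs'0 d).1 c' hc'
  obtain ⟨c₂', hc₂', hc₂'eq⟩ :=
    (pathIndep_cen_local P hP (pathIndep_fg_adjoin hB' s'⁻¹) hsB₁' hs0 d).1 c₁' hc₁'
  -- transport to `C` and pull back down to `B`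
  obtain ⟨c₂, hc₂, hc₂eq⟩ := pathIndep_cen_congr P hC d c₂' hc₂'
  obtain ⟨c₁, hc₁, e', hc₁eq⟩ :=
    (pathIndep_cen_local P hP (pathIndep_fg_adjoin hB s⁻¹) hs'B₁ hs'0 d).2 c₂ hc₂
  obtain ⟨c, hc, e, hceq⟩ := (pathIndep_cen_local P hP hB hs hs0 d).2 c₁ hc₁
  refine ⟨c, hc, e, e', ?_⟩
  rw [← hc₁'eq, ← hc₂'eq, ← hc₂eq, hc₁eq, hceq]

/-- **Chart comparison** (one inclusion): if the centre ideals of `B` and `B'` generate each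
other up to the units `s`, `s'` of `O`, and `risoLoc O B = risoLoc O B'`, then the admissible
chart `B'[Cen'/x']` lies in the local ring at the centre of `O` of the admissible chart
`B[Cen/x]`: indeed `x'/x` is then a unit of `O` inside that local ring. [folklore] -/
theorem pathIndep_le {k K : Type} [Field k] [Field K] [Algebra k K]
    (P : ∀ B : Subalgebra k K, Ideal ↥B → ℕ → Prop) {O : ValuationSubring K}
    {B B' : Subalgebra k K} (hBO : B.toSubring ≤ O.toSubring) (hB'O : B'.toSubring ≤ O.toSubring)
    (hloc : risoLoc O B = risoLoc O B') {s s' : K} (hs : s ∈ B) (hs' : s' ∈ B') (hsO : s⁻¹ ∈ O)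
    (hs'O : s'⁻¹ ∈ O) {d : ℕ}
    (hstar : ∀ c' ∈ risoCen P B' d, ∃ c ∈ risoCen P B d, ∃ e e' : ℕ,
      (c' : K) = c * (s ^ e)⁻¹ * (s' ^ e')⁻¹)
    (hstar' : ∀ c ∈ risoCen P B d, ∃ c' ∈ risoCen P B' d, ∃ e' e : ℕ,
      (c : K) = c' * (s' ^ e')⁻¹ * (s ^ e)⁻¹)
    {xt xt' : K} (hV : risoValid P O B d xt) (hV' : risoValid P O B' d xt') :
    risoStep P B' d xt' ≤ risoLoc O (risoStep P B d xt) := by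
  have hL : risoLoc O B ≤ risoLoc O (risoStep P B d xt) := risoLoc_mono O (le_risoStep P B d xt)
  have hS₁O : (risoStep P B d xt).toSubring ≤ O.toSubring := risoStep_toSubring_le hBO hV
  have hsL : s⁻¹ ∈ risoLoc O B := inv_mem_risoLoc hBO (le_risoLoc O B hs) hsO
  have hs'L : s'⁻¹ ∈ risoLoc O B := by
    rw [hloc]; exact inv_mem_risoLoc hB'O (le_risoLoc O B' hs') hs'O
  -- `c' / x ∈ L₁` for `c' ∈ Cen(B')`
  have hfrac : ∀ c' ∈ risoCen P B' d, (c' : K) * xt⁻¹ ∈ risoLoc O (risoStep P B d xt) := by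
    intro c' hc'
    obtain ⟨c, hc, e, e', hceq⟩ := hstar c' hc'
    have : (c' : K) * xt⁻¹ = (c : K) * xt⁻¹ * (s⁻¹ ^ e * s'⁻¹ ^ e') := by
      rw [hceq, inv_pow, inv_pow]; ring
    rw [this]
    exact Subalgebra.mul_mem _ (le_risoLoc O _ (mul_inv_mem_risoStep P hc))
      (Subalgebra.mul_mem _ (hL (Subalgebra.pow_mem _ hsL e)) (hL (Subalgebra.pow_mem _ hs'L e')))
  -- `x' / x ∈ L₁` is a unit of `O`, hence `x / x' ∈ L₁`
  have hw : xt' * xt⁻¹ ∈ risoLoc O (risoStep P B d xt) := by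
    obtain ⟨x₀', hx₀', hx₀'eq⟩ := hV'.2.1
    rw [← hx₀'eq]; exact hfrac x₀' hx₀'
  have hwO : (xt' * xt⁻¹)⁻¹ ∈ O := by
    obtain ⟨x₀, hx₀, hx₀eq⟩ := hV.2.1
    obtain ⟨c', hc', e', e, hceq⟩ := hstar' x₀ hx₀
    have : (xt' * xt⁻¹)⁻¹ = (c' : K) * xt'⁻¹ * (s'⁻¹ ^ e' * s⁻¹ ^ e) := by
      rw [mul_inv, inv_inv, ← hx₀eq, hceq, inv_pow, inv_pow]; ring
    rw [this]
    exact mul_mem (hV'.2.2 c' hc') (mul_mem (pow_mem hs'O e') (pow_mem hsO e))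
  have hw' : xt * xt'⁻¹ ∈ risoLoc O (risoStep P B d xt) := by
    have := inv_mem_risoLoc hS₁O hw hwO
    rwa [mul_inv, inv_inv, mul_comm] at this
  refine Algebra.adjoin_le ?_
  rintro y (hy | ⟨a, ha, rfl⟩)
  · exact hL (hloc ▸ le_risoLoc O B' hy)
  · have : (a : K) * xt'⁻¹ = (a : K) * xt⁻¹ * (xt * xt'⁻¹) := by
      rw [mul_assoc, ← mul_assoc xt⁻¹, inv_mul_cancel₀ hV.1, one_mul]
    rw [this]
    exact Subalgebra.mul_mem _ (hfrac a ha) hw'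

/-- **Stub (path independence of the tower for a Zariski-local cut predicate).** If the cut
predicate `P` is Zariski-local (`RisoLocal P`), then two finitely generated algebras `B, B' ⊆ O`
with the same local ring `L` at the centre of `O` and a common basic-open refinement
(`B' ⊆ B[s⁻¹]`, `B ⊆ B'[s'⁻¹]` with `s, s'` units of `O`) have centre ideals generating the same
ideal of `L` (the localisation lemma `pathIndep_cen_local`, applied along
`B ⊆ B[s⁻¹] ⊆ B[s⁻¹][s'⁻¹] = B'[s'⁻¹][s⁻¹] ⊇ B'[s'⁻¹] ⊇ B'`: singularity and `P` of maximal ideals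
are preserved under these localisations of Jacobson rings), whence the admissible charts
`B[Cen/x]`, `B'[Cen'/x']` again have the same local ring at the centre of `O` (`x/x'` is a unit
of `O` in both local rings, `pathIndep_le`). [folklore] -/
theorem stub_rcrPathIndep {k K : Type} [Field k] [IsAlgClosed k] [Field K] [Algebra k K]
    (P : ∀ B : Subalgebra k K, Ideal ↥B → ℕ → Prop) (hP : RisoLocal P)
    (O : ValuationSubring K) (B B' : Subalgebra k K) (hB : B.FG) (hB' : B'.FG)
    (hBO : B.toSubring ≤ O.toSubring) (hB'O : B'.toSubring ≤ O.toSubring)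
    (hloc : risoLoc O B = risoLoc O B')
    (href : ∃ s s' : K, s ∈ B ∧ s' ∈ B' ∧ s ≠ 0 ∧ s' ≠ 0 ∧ s⁻¹ ∈ O ∧ s'⁻¹ ∈ O ∧
      (B' : Set K) ⊆ Algebra.adjoin k ((B : Set K) ∪ {s⁻¹}) ∧
      (B : Set K) ⊆ Algebra.adjoin k ((B' : Set K) ∪ {s'⁻¹}))
    (d : ℕ) (xt xt' : K) (hV : risoValid P O B d xt) (hV' : risoValid P O B' d xt') :
    risoLoc O (risoStep P B d xt) = risoLoc O (risoStep P B' d xt') := by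
  obtain ⟨s, s', hs, hs', hs0, hs'0, hsO, hs'O, h₁, h₂⟩ := href
  have hstar := pathIndep_star P hP hB hB' hs hs' hs0 hs'0 h₁ h₂ d
  have hstar' := pathIndep_star P hP hB' hB hs' hs hs'0 hs0 h₂ h₁ d
  apply le_antisymm
  · have := risoLoc_mono O
      (pathIndep_le P hB'O hBO hloc.symm hs' hs hs'O hsO hstar' hstar hV' hV)
    rwa [risoLoc_risoLoc (risoStep_toSubring_le hB'O hV')] at this
  · have := risoLoc_mono O
      (pathIndep_le P hBO hB'O hloc hs hs' hsO hs'O hstar hstar' hV hV')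
    rwa [risoLoc_risoLoc (risoStep_toSubring_le hBO hV)] at this

end Summit.ResolutionOfSingularities.ResolutionOfSingularities.Theorems

end
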